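import Literature.AlgebraicGeometry.HodgeTheory.AbelianVarietyCyclotomicAutomorphismCMType
import Literature.AlgebraicGeometry.HodgeTheory.AbelianVarietyAnalyticTypeProductsPowers
import HarnessLib

/-!
# Powers with the DIAGONAL cyclotomic action: `n_ζ(δ^{(ι)}) = |ι| · n_ζ(δ)`, `Φ(δ^{(ι)}) = Φ(δ)`; the Weil classes
# `W_{ℚ(ζ_m)}(A^ι) ⊂ H^{|ι| r}` are Hodge iff those of `A` are; at the CM level they NEVER are — on a power of a
# CM-level `(A, δ)` with `ℚ(ζ_m)` acting diagonally, `0` is the only rational Hodge class among the Weil classes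

Family `hodge`, lane `lit-hodgefound` (seat p03, GEN 36 «Hodge classes from the analytic type of a cyclotomic
automorphism»), topic `Literature/AlgebraicGeometry/HodgeTheory`.  Theorems only: no definition, no instance, no named
fact (net Literature debt 0).  Junction BY NAME of GEN 35's biproduct calculus (`AbelianVarietyAnalyticTypeProductsPowers`:
`eigenMultiplicity_biproduct_map_eq_sum`, `eval₂_biproduct_map_eq_zero_of_forall`, `dim_zarhinExample`) with GEN 36's
`…WeilClasses` (Moonen–Zarhin's Criterion for `F = ℚ(ζ_m)`: `W ⊗ ℂ` is of type `(r/2, r/2)` iff `n_ζ = n_{ζ⁻¹}` on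
`μ_m^×`; dichotomy) and `…CMType` (`n_ζ + n_{ζ⁻¹} = 1` at the CM level).

On the power `A^ι = ⨁_{j ∈ ι} A` with the diagonal endomorphism `δ^{(ι)} = biproduct.map (fun _ ↦ δ)`, `Φ_m(δ^{(ι)}) = 0`,
the multiplicities multiply by `|ι|` and `r` becomes `|ι| · r`; Moonen–Zarhin's condition `n_σ = n_σ̄` is insensitive to
the factor `|ι|`, so the Weil classes of the power are Hodge exactly when those of `A` are (van Geemen's remark that for
Weil type one may pass to `A = B^k`; Moonen–Zarhin §2 «we may even assume that `X = Y^m`»).  At the CM level `φ(m) = 2 dim A`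
the condition fails for `A` (`n_ζ + n_{ζ⁻¹} = 1`), hence for every power: the diagonal `ℚ(ζ_m)`-structure on `A^ι`
carries no non-zero rational Hodge class among its Weil classes (degree `|ι|`) — Weil's classes on powers of CM abelian
varieties require a non-diagonal field action.

## Sources, verbatim (held texts)

B. Moonen, Yu. Zarhin, *Weil classes on abelian varieties* (1998), held `paper:arxiv-alg-geom_9612017`, §1 (chunk p0001
L70–L84): «`r = 2g/[F : ℚ]` […] Criterion: `W_F` consists of Hodge classes if and only if `n_σ = n_σ̄` for all `σ`»,
(L60–L67) «either `W_F` consists entirely of Hodge classes, or `0 ∈ W_F` is the only Hodge class»; §2 (chunk p0002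
L44–L46): «Since everything only depends on `X` up to isogeny, we may even assume that `X = Y^m` for some `m ≥ 1`, where
`Y` is simple».

B. van Geemen, *An introduction to the Hodge conjecture for abelian varieties*, LNM 1594 (1994) [vanGeemen1994HodgeAV],
6.7–6.12 (abelian varieties of Weil type `A = B^k` with `K ⊂ End(B) ⊗ ℚ` acting diagonally; the space `W_K ⊂ B^n(A)`).

## What is proved (namespace `Literature.AlgebraicGeometry.HodgeTheory.AbelianVariety`)

* §1 (any `(A, δ)`, `Φ_m(δ) = 0`) `eval₂_cyclotomic_diagonal_eq_zero`, **`eigenMultiplicity_diagonal_eq_card_mul`**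
  (`n_ζ(δ^{(ι)}) = |ι| · n_ζ(δ)`), **`cmTypeOf_diagonal_eq`** (`Φ(δ^{(ι)}) = Φ(δ)`, `ι` non-empty),
  `totient_mul_card_mul_eq_two_mul_dim_diagonal` (the Weil degree of the power is `|ι| · r`);
* §2 **`forall_isOfHodgeType_weilClassesField_diagonal_iff`** (`W(A^ι) ⊗ ℂ` is of type `(|ι|r/2, |ι|r/2)` iff
  `n_ζ(δ) = n_{ζ⁻¹}(δ)` on `μ_m^×`) and **`…_iff_forall_isOfHodgeType_weilClassesField`** (iff the same for `A`);
* §3 (CM level `φ(m) = 2 dim A`) **`not_forall_isOfHodgeType_weilClassesField_diagonal`** and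
  **`eq_zero_of_mem_weilClassesField_diagonal`** (`0` is the only rational Hodge class in `W(A^ι)`, `ι` non-empty;
  the degree is written `|ι| · 1`, the `r = 1` instance of §2's `|ι| · r`).

## References

* [MoonenZarhin1998WeilClasses] B. Moonen, Yu. Zarhin, J. reine angew. Math. 496 (1998), §1–§2 (chunks p0001–p0002).
* [vanGeemen1994HodgeAV] B. van Geemen, LNM 1594 (1994), 6.7–6.12.
* [LangeRodriguez2022] H. Lange, R. E. Rodríguez, LNM 2310 (2022), §2.9.1 Thm. 2.9.1 (b) (analytic representation of a
  product).
-/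

noncomputable section

open CategoryTheory CategoryTheory.Limits Module Polynomial

namespace Literature.AlgebraicGeometry.HodgeTheory

namespace AbelianVariety

open Literature.AlgebraicTopology.SingularHomology

variable {ι : Type} [Fintype ι] {A : Motives.AbelianVariety ℂ} {δ : A ⟶ A} {m r : ℕ}

/-! ## §1 The analytic type of the diagonal action -/

/-- `Φ_m(δ^{(ι)}) = 0` on `A^ι = ⨁_ι A` for the diagonal `δ^{(ι)} = ⊕_j δ`. [cite: LangeRodriguez2022, §2.9.1 Thm. 2.9.1 (b) (PDF p. 43)] -/
theorem eval₂_cyclotomic_diagonal_eq_zero (hδ : (cyclotomic m ℤ).eval₂ (Int.castRingHom (End A)) (End.of δ) = 0) :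
    (cyclotomic m ℤ).eval₂ (Int.castRingHom (End (⨁ fun _ : ι ↦ A)))
      (End.of (biproduct.map fun _ : ι ↦ δ)) = 0 :=
  eval₂_biproduct_map_eq_zero_of_forall (fun _ : ι ↦ δ) (cyclotomic m ℤ) fun _ ↦ hδ

/-- **`n_ζ(δ^{(ι)}) = |ι| · n_ζ(δ)`**: the multiplicities of the diagonal action on `A^ι` («the analytic representation
of the product is the direct sum»). [cite: LangeRodriguez2022, §2.9.1 Thm. 2.9.1 (b) (PDF p. 43) and §2.9.2 (PDF p. 46)]
[cite: MoonenZarhin1998WeilClasses, §1 (chunk p0001 L70–L76)] -/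
theorem eigenMultiplicity_diagonal_eq_card_mul (hm : 0 < m)
    (hδ : (cyclotomic m ℤ).eval₂ (Int.castRingHom (End A)) (End.of δ) = 0) (ζ : ℂ) :
    eigenMultiplicity (⨁ fun _ : ι ↦ A) (biproduct.map fun _ : ι ↦ δ) ζ = Fintype.card ι * eigenMultiplicity A δ ζ := by
  classical
  rw [eigenMultiplicity_biproduct_map_eq_sum (fun _ : ι ↦ δ) hm (fun _ ↦ pow_eq_one_of_cyclotomic hδ) ζ,
    Finset.sum_const, Finset.card_univ, smul_eq_mul]

/-- **`Φ(δ^{(ι)}) = Φ(δ)`**: the CM type (`{t | n_{e^{2πit/m}} ≠ 0}`) of the diagonal action on a power is that of `A`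
(`ι` non-empty). [cite: MoonenZarhin1998WeilClasses, §2 (chunk p0002 L44–L46)] -/
theorem cmTypeOf_diagonal_eq [Nonempty ι] (hm : 0 < m)
    (hδ : (cyclotomic m ℤ).eval₂ (Int.castRingHom (End A)) (End.of δ) = 0) :
    cmTypeOf (⨁ fun _ : ι ↦ A) (biproduct.map fun _ : ι ↦ δ) m = cmTypeOf A δ m := by
  ext t
  rw [mem_cmTypeOf_iff_eigenMultiplicity_ne_zero, mem_cmTypeOf_iff_eigenMultiplicity_ne_zero,
    eigenMultiplicity_diagonal_eq_card_mul hm hδ, mul_ne_zero_iff]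
  exact ⟨fun h ↦ h.2, fun h ↦ ⟨Fintype.card_ne_zero, h⟩⟩

/-- The Weil degree of the power: `φ(m) · (|ι| · r) = 2 dim A^ι` when `φ(m) · r = 2 dim A`.
[cite: MoonenZarhin1998WeilClasses, §1 (chunk p0001 L70–L72: r = 2g/[F:ℚ])] -/
theorem totient_mul_card_mul_eq_two_mul_dim_diagonal (hr : Nat.totient m * r = 2 * A.dim) :
    Nat.totient m * (Fintype.card ι * r) = 2 * (⨁ fun _ : ι ↦ A).dim := by
  rw [dim_zarhinExample (E := A) (ι := ι), mul_left_comm, hr]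
  ring

/-! ## §2 The Weil classes of the power are Hodge iff those of `A` are -/

/-- **Moonen–Zarhin's Criterion on the power**: every class of `W_{ℚ(ζ_m)}(A^ι) ⊗ ℂ ⊂ H^{|ι| r}` is of type
`(|ι|r/2, |ι|r/2)` iff `n_ζ(δ) = n_{ζ⁻¹}(δ)` for every primitive `ζ` — the condition for `A` itself (the factor `|ι|`
cancels). [cite: MoonenZarhin1998WeilClasses, §1 Criterion (chunk p0001 L80–L84), §2 (chunk p0002 L44–L46)] [cite: vanGeemen1994HodgeAV, 6.7–6.12] -/
theorem forall_isOfHodgeType_weilClassesField_diagonal_iff [Nonempty ι] (hm : 0 < m)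
    (hδ : (cyclotomic m ℤ).eval₂ (Int.castRingHom (End A)) (End.of δ) = 0) (hr : Nat.totient m * r = 2 * A.dim) :
    (∀ c ∈ weilClassesField (⨁ fun _ : ι ↦ A) (biproduct.map fun _ : ι ↦ δ) (cyclotomic m ℤ) (Fintype.card ι * r),
        IsOfHodgeType (⨁ fun _ : ι ↦ A).dim (⨁ fun _ : ι ↦ A).X (Fintype.card ι * r)
          (Fintype.card ι * r / 2) (Fintype.card ι * r / 2) c) ↔
      ∀ ζ : ℂ, IsPrimitiveRoot ζ m → eigenMultiplicity A δ ζ = eigenMultiplicity A δ ζ⁻¹ := by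
  rw [forall_isOfHodgeType_weilClassesField_cyclotomic_iff hm (eval₂_cyclotomic_diagonal_eq_zero hδ)
    (totient_mul_card_mul_eq_two_mul_dim_diagonal hr)]
  refine forall_congr' fun ζ ↦ forall_congr' fun _ ↦ ?_
  rw [eigenMultiplicity_diagonal_eq_card_mul hm hδ, eigenMultiplicity_diagonal_eq_card_mul hm hδ]
  exact Nat.mul_right_inj Fintype.card_ne_zero

/-- **`W(A^ι)` is Hodge iff `W(A)` is Hodge** (diagonal action, same field `ℚ(ζ_m)`; `φ(m) · r = 2 dim A`).
[cite: MoonenZarhin1998WeilClasses, §1 Criterion (chunk p0001 L80–L84), §2 (chunk p0002 L44–L46)] [cite: vanGeemen1994HodgeAV, 6.7–6.12] -/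
theorem forall_isOfHodgeType_weilClassesField_diagonal_iff_forall_isOfHodgeType_weilClassesField [Nonempty ι] (hm : 0 < m)
    (hδ : (cyclotomic m ℤ).eval₂ (Int.castRingHom (End A)) (End.of δ) = 0) (hr : Nat.totient m * r = 2 * A.dim) :
    (∀ c ∈ weilClassesField (⨁ fun _ : ι ↦ A) (biproduct.map fun _ : ι ↦ δ) (cyclotomic m ℤ) (Fintype.card ι * r),
        IsOfHodgeType (⨁ fun _ : ι ↦ A).dim (⨁ fun _ : ι ↦ A).X (Fintype.card ι * r)
          (Fintype.card ι * r / 2) (Fintype.card ι * r / 2) c) ↔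
      ∀ c ∈ weilClassesField A δ (cyclotomic m ℤ) r, IsOfHodgeType A.dim A.X r (r / 2) (r / 2) c := by
  rw [forall_isOfHodgeType_weilClassesField_diagonal_iff hm hδ hr,
    forall_isOfHodgeType_weilClassesField_cyclotomic_iff hm hδ hr]

/-- **The dichotomy on the power**: `W(A^ι)` contains a non-zero rational Hodge class iff `n_ζ(δ) = n_{ζ⁻¹}(δ)` on `μ_m^×`
(`r ≠ 0`, `ι` non-empty). [cite: MoonenZarhin1998WeilClasses, §1 «all or nothing» (chunk p0001 L60–L67) and Criterion (L80–L84)] -/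
theorem exists_isRationalClass_isOfHodgeType_ne_zero_diagonal_iff [Nonempty ι] (hm : 0 < m)
    (hδ : (cyclotomic m ℤ).eval₂ (Int.castRingHom (End A)) (End.of δ) = 0) (hr : Nat.totient m * r = 2 * A.dim)
    (hr0 : r ≠ 0) :
    (∃ γ ∈ weilClassesField (⨁ fun _ : ι ↦ A) (biproduct.map fun _ : ι ↦ δ) (cyclotomic m ℤ) (Fintype.card ι * r),
        IsRationalClass γ ∧ IsOfHodgeType (⨁ fun _ : ι ↦ A).dim (⨁ fun _ : ι ↦ A).X (Fintype.card ι * r)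
          (Fintype.card ι * r / 2) (Fintype.card ι * r / 2) γ ∧ γ ≠ 0) ↔
      ∀ ζ : ℂ, IsPrimitiveRoot ζ m → eigenMultiplicity A δ ζ = eigenMultiplicity A δ ζ⁻¹ := by
  rw [exists_isRationalClass_isOfHodgeType_ne_zero_cyclotomic_iff hm (eval₂_cyclotomic_diagonal_eq_zero hδ)
    (totient_mul_card_mul_eq_two_mul_dim_diagonal hr) (mul_ne_zero Fintype.card_ne_zero hr0)]
  refine forall_congr' fun ζ ↦ forall_congr' fun _ ↦ ?_
  rw [eigenMultiplicity_diagonal_eq_card_mul hm hδ, eigenMultiplicity_diagonal_eq_card_mul hm hδ]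
  exact Nat.mul_right_inj Fintype.card_ne_zero

/-! ## §3 The CM level: the diagonal Weil classes of a power are never Hodge -/

/-- **At the CM level `φ(m) = 2 dim A`, NOT every class of `W_{ℚ(ζ_m)}(A^ι) ⊗ ℂ ⊂ H^{|ι|}` is of type `(|ι|/2, |ι|/2)`**
(`n_ζ + n_{ζ⁻¹} = 1` forbids `n_ζ = n_{ζ⁻¹}`). [cite: MoonenZarhin1998WeilClasses, §1 Criterion (chunk p0001 L78–L84), §2 (chunk p0002 L44–L46)] -/
theorem not_forall_isOfHodgeType_weilClassesField_diagonal [Nonempty ι] (hm : 0 < m)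
    (hδ : (cyclotomic m ℤ).eval₂ (Int.castRingHom (End A)) (End.of δ) = 0) (hg : Nat.totient m = 2 * A.dim) :
    ¬ ∀ c ∈ weilClassesField (⨁ fun _ : ι ↦ A) (biproduct.map fun _ : ι ↦ δ) (cyclotomic m ℤ) (Fintype.card ι * 1),
        IsOfHodgeType (⨁ fun _ : ι ↦ A).dim (⨁ fun _ : ι ↦ A).X (Fintype.card ι * 1)
          (Fintype.card ι * 1 / 2) (Fintype.card ι * 1 / 2) c := by
  rw [forall_isOfHodgeType_weilClassesField_diagonal_iff hm hδ (r := 1) (by rw [mul_one, hg])]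
  intro h
  have hζ : IsPrimitiveRoot (Complex.exp (2 * Real.pi * Complex.I / m)) m := Complex.isPrimitiveRoot_exp m hm.ne'
  have h1 := add_eigenMultiplicity_inv_eq_one hm hδ hg hζ
  have h2 := h _ hζ
  omega

/-- **`0` is the only rational Hodge class among the Weil classes of the diagonal `ℚ(ζ_m)`-structure on a power of a
CM-level `(A, δ)`.** [cite: MoonenZarhin1998WeilClasses, §1 «all or nothing» (chunk p0001 L60–L67) and Criterion (L78–L84)] -/
theorem eq_zero_of_mem_weilClassesField_diagonal [Nonempty ι] (hm : 0 < m)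
    (hδ : (cyclotomic m ℤ).eval₂ (Int.castRingHom (End A)) (End.of δ) = 0) (hg : Nat.totient m = 2 * A.dim)
    {c : complexBetti (⨁ fun _ : ι ↦ A).X (Fintype.card ι * 1)}
    (hc : c ∈ weilClassesField (⨁ fun _ : ι ↦ A) (biproduct.map fun _ : ι ↦ δ) (cyclotomic m ℤ) (Fintype.card ι * 1))
    (hcQ : IsRationalClass c)
    (hcH : IsOfHodgeType (⨁ fun _ : ι ↦ A).dim (⨁ fun _ : ι ↦ A).X (Fintype.card ι * 1)
      (Fintype.card ι * 1 / 2) (Fintype.card ι * 1 / 2) c) : c = 0 := by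
  have hr : Nat.totient m * 1 = 2 * A.dim := by rw [mul_one, hg]
  refine eq_zero_of_mem_weilClassesField_cyclotomic hm (eval₂_cyclotomic_diagonal_eq_zero hδ)
    (totient_mul_card_mul_eq_two_mul_dim_diagonal hr) ?_ hc hcQ hcH
  have hζ : IsPrimitiveRoot (Complex.exp (2 * Real.pi * Complex.I / m)) m := Complex.isPrimitiveRoot_exp m hm.ne'
  refine ⟨_, hζ, ?_⟩
  rw [eigenMultiplicity_diagonal_eq_card_mul hm hδ, eigenMultiplicity_diagonal_eq_card_mul hm hδ]
  intro h
  have h1 := add_eigenMultiplicity_inv_eq_one hm hδ hg hζ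
  have h2 : eigenMultiplicity A δ _ = eigenMultiplicity A δ _ := Nat.eq_of_mul_eq_mul_left Fintype.card_pos h
  omega

/-- **Hence `W(A^ι)` contains NO non-zero rational Hodge class** (CM level, diagonal action).
[cite: MoonenZarhin1998WeilClasses, §1 «all or nothing» (chunk p0001 L60–L67), §2 (chunk p0002 L44–L46)] -/
theorem not_exists_isRationalClass_isOfHodgeType_ne_zero_diagonal [Nonempty ι] (hm : 0 < m)
    (hδ : (cyclotomic m ℤ).eval₂ (Int.castRingHom (End A)) (End.of δ) = 0) (hg : Nat.totient m = 2 * A.dim) :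
    ¬ ∃ γ ∈ weilClassesField (⨁ fun _ : ι ↦ A) (biproduct.map fun _ : ι ↦ δ) (cyclotomic m ℤ) (Fintype.card ι * 1),
        IsRationalClass γ ∧ IsOfHodgeType (⨁ fun _ : ι ↦ A).dim (⨁ fun _ : ι ↦ A).X (Fintype.card ι * 1)
          (Fintype.card ι * 1 / 2) (Fintype.card ι * 1 / 2) γ ∧ γ ≠ 0 := by
  rintro ⟨γ, hγ, hγQ, hγH, hγ0⟩
  exact hγ0 (eq_zero_of_mem_weilClassesField_diagonal hm hδ hg hγ hγQ hγH)

end AbelianVariety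

end Literature.AlgebraicGeometry.HodgeTheory

end
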